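import Literature.Probability.RandomPlanarGeometry.HalfPlaneFill
import HarnessLib

/-!
# Anchored hulls of half-plane sets and continuity of `Φ'_A(0)` under inner exhaustion

Half-plane topology and one classical named fact for step T6 of the transposition of [LSW]
Thm. 6.1 to `Literature.Probability.RandomPlanarGeometry.IsSLELaw.hullRestriction_eightThirds` (plan in `ConformalRestrictionProofs`):

* G. F. Lawler, O. Schramm, W. Werner, *Conformal restriction: the chordal case*, J. Amer. Math.
  Soc. **16** (2003), arXiv:math/0209343 (**[LSW]**).

The tree's restriction property conditions on the event `{γ ⊆ cl D'}` = "the trace misses the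
INTERIOR (relative to `ℍ`) of the pulled-back hull `A`", whereas [LSW] Thm. 6.1 computes
`P[γ ∩ A = ∅] = Φ'_A(0)^{5/8}` for the closed hull. That the two events differ by a null set is
obtained by exhausting the interior of `A` by `*`-hulls `B_n ↑` and letting `n → ∞` in
`P[γ ∩ B_n = ∅] = Φ'_{B_n}(0)^{5/8}`; the limit is the CONTINUITY of `A ↦ Φ'_A(0)` under
kernel convergence, NAMED here as the fact `Literature.Probability.RandomPlanarGeometry.HasRestrictionDeriv.tendsto_of_kernel`. That
fact is NOT printed as such in [LSW]: it combines the Carathéodory kernel theorem (Pommerenke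
(1992), Thm. 1.8 with Exercise 1.4.2; for half-plane hulls Lawler (2005), Prop. 3.63,
Def. 3.67, Prop. 3.68) with the remark in the PROOF of [LSW] Lemma 3.5, p. 12 ("It is
immediate that `Φ'_{A_n}(0) → Φ'_A(0)`, by Cauchy's derivative formula (the maps may be
extended to a neighborhood of `0` by Schwarz reflection in the real line)"), generalised from
the printed `𝒬₊` to `𝒬*`; see its docstring. Lower bounds (so that an exhaustion by anchored
hulls is not trivially empty): `inter_subset_anchoredHull` (`S ∩ ℍ ⊆ anchoredHull S`) and
`anchoredHull_eq_hpFill` for sets attached to the lower half-plane (`S ∪ {Im ≤ 0}` connected);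
the kernel hypothesis for the erosion exhaustion of a pulled-back hull is established in the
consumer file `HullRestrictionNull` (`exists_mem_anchoredHull_erosion`,
`interior_iInter_diff_anchoredHull_erosion`).

The `*`-hulls of the exhaustion must have simply connected complement, which fails for the fill
`hpFill S` of a set `S` with floating pieces. PROVED here: the **anchored hull**
`Literature.anchoredHull S = closure (ℍ ∩ C)`, `C` the connected component of `{Im ≤ 0}` in the
complement of the unbounded component `V` of `ℍ ∖ S` — i.e. the fill of `S` with the floating
pieces (the other components of `ℂ ∖ V`) given back to the complement:

* `isConnected_compl_anchorComponent` — `ℂ ∖ C = V ∪ (other components)` is open and connected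
  (each component of the closed set `ℂ ∖ V` meets `closure V`, else it would be clopen in `ℂ`);
* `isStarHull_anchoredHull` — `anchoredHull S ∈ 𝒬*` for `S` closed, bounded with
  `0 ∉ hpFill S` (simple connectivity by `isSimplyConnected_of_isConnected_compl`, the
  complement `C ⊇ {Im ≤ 0}` of `ℂ ∖ C` being connected and unbounded);
* `anchoredHull_subset_hpFill`, `anchoredHull_mono`, and `disjoint_range_anchoredHull`: a
  transient path from `0` in `ℍ ∪ {0}` avoiding `S` avoids `anchoredHull S`.
-/

noncomputable section

open Set Filter Topology Metric Bornology Complex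
open UpperHalfPlane (upperHalfPlaneSet isOpen_upperHalfPlaneSet)
open scoped NNReal

namespace Literature.Probability.RandomPlanarGeometry

/-! ### Named fact: continuity of `Φ'_A(0)` under kernel convergence -/

/-- NAMED FACT — **continuity of `Φ'_A(0)` under an increasing exhaustion (Carathéodory kernel
convergence).** Let `A ∈ 𝒬*` and `A_n ∈ 𝒬*` with `A_n ⊆ A_{n+1} ⊆ A`, and suppose the kernel
of the decreasing domains `ℍ ∖ A_n` is `ℍ ∖ A`: `int (⋂ₙ (ℍ ∖ A_n)) = ℍ ∖ A`. Then
`Φ'_{A_n}(0) → Φ'_A(0)` (for the numbers `d_n, d` of `HasRestrictionDeriv`).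

**Provenance — this is NOT a statement printed in [LSW]; it combines two printed results.**
(a) [LSW] Lemma 3.5 (p. 12) reads, verbatim: "There exists a topology on `𝒬₊` for which `𝒜₀`
is dense, `F` is continuous, and `Φ_A ↦ Φ'_A(0)` is continuous", where (proof, p. 12) "we say
that `A_n ∈ 𝒬₊` converges to `A ∈ 𝒬₊` if `Φ_{A_n}` converges to `Φ_A` uniformly on compact
subsets of `ℍ̄ ∖ A` and `⋃ₙ A_n` is bounded away from `0` and `∞`", and the step used here is
the remark in its PROOF: "It is immediate that `Φ'_{A_n}(0) → Φ'_A(0)`, by Cauchy's derivative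
formula (the maps may be extended to a neighborhood of `0` by Schwarz reflection in the real
line)." (b) The Carathéodory kernel theorem — Pommerenke (1992), Thm. 1.8, with Exercise 1.4.2
(a decreasing sequence of domains converges to the component of the open kernel of its
intersection); for half-plane hulls with the hydrodynamic normalisation `g_A(z) − z → 0`:
Lawler (2005), Prop. 3.63, Def. 3.67 ("`A_n → A` if `g_{A_n}⁻¹ → g_A⁻¹` uniformly away from
`ℝ`") and Prop. 3.68 — turns the kernel hypothesis into that local uniform convergence of the
normalised maps. The present def is thus (b) + the reflection remark of (a), stated for ALL of
`𝒬*` (generalised from the printed `𝒬₊`: nothing in either argument uses the sign of the real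
points of `A`) and with [LSW]'s convergence notion REPLACED by the kernel hypothesis on
increasing `A_n ⊆ A` (which yields it by (b); `⋃ A_n ⊆ A ∌ 0` is automatically bounded away
from `0` and `∞`). The hypothesis `∀ n, A_n ⊆ A` is redundant given the kernel hypothesis
(`A_n = closure (A_n ∩ ℍ) ⊆ A`) and is kept for convenience.
[cite: LawlerSchrammWerner2003Restriction, Lemma 3.5 and its proof (p. 12)]
[cite: PommerenkeBBCM1992, Thm. 1.8 with Exercise 1.4.2]
[cite: Lawler2005, Prop. 3.63, Def. 3.67, Prop. 3.68] -/
def HasRestrictionDeriv.tendsto_of_kernel : Prop :=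
  ∀ {A : Set ℂ} {An : ℕ → Set ℂ} {Φ : ConformalEquiv (upperHalfPlaneSet \ A) upperHalfPlaneSet}
    {Φn : ∀ n, ConformalEquiv (upperHalfPlaneSet \ An n) upperHalfPlaneSet} {d : ℝ} {dn : ℕ → ℝ},
    IsStarHull A → (∀ n, IsStarHull (An n)) → Monotone An → (∀ n, An n ⊆ A) →
    interior (⋂ n, upperHalfPlaneSet \ An n) = upperHalfPlaneSet \ A →
    IsRestrictionMap A Φ → HasRestrictionDeriv A Φ d →
    (∀ n, IsRestrictionMap (An n) (Φn n)) → (∀ n, HasRestrictionDeriv (An n) (Φn n) (dn n)) →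
    Tendsto dn atTop (𝓝 d)

/-! ### Components of closed sets -/

/-- A connected component of a closed set is closed. [folklore] -/
theorem isClosed_connectedComponentIn {F : Set ℂ} (hF : IsClosed F) (x : ℂ) :
    IsClosed (connectedComponentIn F x) := by
  by_cases hx : x ∈ F
  · refine isClosed_of_closure_subset ?_
    exact isPreconnected_connectedComponentIn.closure.subset_connectedComponentIn
      (subset_closure (mem_connectedComponentIn hx))
      ((closure_mono (connectedComponentIn_subset F x)).trans hF.closure_subset)
  · rw [connectedComponentIn_eq_empty hx]
    exact isClosed_empty

/-- Distinct components are disjoint: a point of one component lying in another makes them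
equal. [folklore] -/
theorem connectedComponentIn_eq_of_mem_of_mem {F : Set ℂ} {x y z : ℂ}
    (hx : z ∈ connectedComponentIn F x) (hy : z ∈ connectedComponentIn F y) :
    connectedComponentIn F x = connectedComponentIn F y :=
  (connectedComponentIn_eq hx).trans (connectedComponentIn_eq hy).symm

/-! ### The anchored complement of an open connected set -/

section Anchored

variable {V : Set ℂ}

/-- **Every component of the complement of a nonempty open set `V` meets `closure V`.**
Otherwise the component lies in the open set `(closure V)ᶜ ⊆ Vᶜ`, where it is a component,
hence open; being also closed (a component of the closed set `Vᶜ`), it would be all of the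
connected space `ℂ`, contradicting `V ≠ ∅`. [folklore] -/
theorem connectedComponentIn_compl_inter_closure_nonempty (hV : IsOpen V) (hVne : V.Nonempty)
    {z : ℂ} (hz : z ∈ Vᶜ) : (connectedComponentIn Vᶜ z ∩ closure V).Nonempty := by
  by_contra h
  rw [not_nonempty_iff_eq_empty] at h
  set K := connectedComponentIn Vᶜ z with hK
  have hKO : K ⊆ (closure V)ᶜ := fun w hw hwc ↦ (Set.ext_iff.1 h w).1 ⟨hw, hwc⟩
  -- `K` is the component of `z` in the open set `(closure V)ᶜ`, hence open
  have hzO : z ∈ (closure V)ᶜ := hKO (mem_connectedComponentIn hz)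
  have hKeq : K = connectedComponentIn (closure V)ᶜ z := by
    refine Subset.antisymm ?_ ?_
    · exact isPreconnected_connectedComponentIn.subset_connectedComponentIn
        (mem_connectedComponentIn hz) hKO
    · exact isPreconnected_connectedComponentIn.subset_connectedComponentIn
        (mem_connectedComponentIn hzO)
        ((connectedComponentIn_subset _ _).trans (compl_subset_compl.2 subset_closure))
  have hKopen : IsOpen K := by
    rw [hKeq]
    exact isClosed_closure.isOpen_compl.connectedComponentIn
  have hKclosed : IsClosed K := isClosed_connectedComponentIn hV.isClosed_compl z
  rcases isClopen_iff.1 ⟨hKclosed, hKopen⟩ with h0 | huniv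
  · exact absurd (mem_connectedComponentIn (F := Vᶜ) hz) (by rw [← hK, h0]; exact notMem_empty _)
  · obtain ⟨v, hv⟩ := hVne
    have : v ∈ K := by rw [huniv]; exact mem_univ _
    exact (connectedComponentIn_subset _ _ this) hv

/-- **The union of an open connected set with any family of components of its complement is
connected**; here: with all components other than a given one `C`, i.e. `Cᶜ` is connected
when `C` is a component of `Vᶜ` (`V` open, connected, nonempty; for `c ∈ V` the statement is
about `∅ᶜ`). [folklore] -/
theorem isConnected_compl_connectedComponentIn (hV : IsOpen V) (hVc : IsConnected V) (c : ℂ) :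
    IsConnected (connectedComponentIn Vᶜ c)ᶜ := by
  set C := connectedComponentIn Vᶜ c with hC
  obtain ⟨v₀, hv₀⟩ := hVc.nonempty
  have hVC : V ⊆ Cᶜ := fun v hv hvC ↦ (connectedComponentIn_subset _ _ hvC) hv
  -- each point of `Cᶜ` lies in a connected subset of `Cᶜ` containing `V`
  have key : ∀ z ∈ Cᶜ, ∃ T : Set ℂ, IsPreconnected T ∧ T ⊆ Cᶜ ∧ v₀ ∈ T ∧ z ∈ T := by
    intro z hzC
    by_cases hzV : z ∈ V
    · exact ⟨V, hVc.isPreconnected, hVC, hv₀, hzV⟩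
    · set K := connectedComponentIn Vᶜ z with hK
      obtain ⟨p, hpK, hpV⟩ :=
        connectedComponentIn_compl_inter_closure_nonempty hV ⟨v₀, hv₀⟩ (show z ∈ Vᶜ from hzV)
      have hKC : K ⊆ Cᶜ := fun w hwK hwC ↦ hzC (by
        rw [hC, ← connectedComponentIn_eq_of_mem_of_mem hwK hwC]
        exact mem_connectedComponentIn (show z ∈ Vᶜ from hzV))
      -- `V ∪ {p}` is preconnected (between `V` and its closure) and meets `K` at `p`
      have h1 : IsPreconnected (V ∪ {p}) :=
        hVc.isPreconnected.subset_closure subset_union_left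
          (union_subset subset_closure (singleton_subset_iff.2 hpV))
      have h2 : IsPreconnected (V ∪ {p} ∪ K) :=
        h1.union' ⟨p, Or.inr rfl, hpK⟩ isPreconnected_connectedComponentIn
      refine ⟨V ∪ {p} ∪ K, h2, ?_, Or.inl (Or.inl hv₀), Or.inr (mem_connectedComponentIn hzV)⟩
      refine union_subset (union_subset hVC ?_) hKC
      exact singleton_subset_iff.2 (hKC hpK)
  choose! T hT using key
  have hrepr : Cᶜ = ⋃ z : {z // z ∈ Cᶜ}, T z.1 :=
    Subset.antisymm (fun z hz ↦ mem_iUnion.2 ⟨⟨z, hz⟩, (hT z hz).2.2.2⟩)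
      (iUnion_subset fun z ↦ (hT z.1 z.2).2.1)
  refine ⟨⟨v₀, hVC hv₀⟩, ?_⟩
  rw [hrepr]
  exact isPreconnected_iUnion ⟨v₀, mem_iInter.2 fun z ↦ (hT z.1 z.2).2.2.1⟩
    fun z ↦ (hT z.1 z.2).1

end Anchored

/-! ### The anchored hull of a half-plane set -/

section Hull

variable {S : Set ℂ}

/-- The **anchor component** of `S`: the connected component of `−i` (i.e. of the lower
half-plane) in the complement of the unbounded component of `ℍ ∖ S`. [folklore] -/
def anchorComponent (S : Set ℂ) : Set ℂ :=
  connectedComponentIn (Loewner.unboundedComponent (upperHalfPlaneSet \ S))ᶜ (-I)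

/-- The **anchored hull** of `S`: the closure of the part in `ℍ` of the anchor component — the
fill `hpFill S` with its floating pieces removed, so that its complement in `ℍ` is simply
connected. [folklore] -/
def anchoredHull (S : Set ℂ) : Set ℂ :=
  closure (upperHalfPlaneSet ∩ anchorComponent S)

/-- The lower half-plane lies in the complement of the unbounded component of `ℍ ∖ S`. [folklore] -/
theorem setOf_im_le_subset_compl_unboundedComponent (S : Set ℂ) :
    {z : ℂ | z.im ≤ 0} ⊆ (Loewner.unboundedComponent (upperHalfPlaneSet \ S))ᶜ :=
  fun z hz hzV ↦ absurd (show 0 < z.im from hzV.1.1) (not_lt.2 hz)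

/-- The lower half-plane lies in the anchor component. [folklore] -/
theorem setOf_im_le_subset_anchorComponent (S : Set ℂ) :
    {z : ℂ | z.im ≤ 0} ⊆ anchorComponent S :=
  (convex_halfSpace_im_le (0 : ℝ)).isPreconnected.subset_connectedComponentIn (by simp)
    (setOf_im_le_subset_compl_unboundedComponent S)

/-- The anchor component misses the unbounded component. [folklore] -/
theorem anchorComponent_subset_compl (S : Set ℂ) :
    anchorComponent S ⊆ (Loewner.unboundedComponent (upperHalfPlaneSet \ S))ᶜ :=
  connectedComponentIn_subset _ _

/-- The anchor component is closed (`S` closed and bounded, so that the unbounded component is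
open). [folklore] -/
theorem isClosed_anchorComponent (hS : IsClosed S) (hSb : IsBounded S) :
    IsClosed (anchorComponent S) :=
  isClosed_connectedComponentIn (isOpen_unboundedComponent hS hSb).isClosed_compl _

/-- The anchor component is connected. [folklore] -/
theorem isConnected_anchorComponent (S : Set ℂ) : IsConnected (anchorComponent S) :=
  isConnected_connectedComponentIn_iff.2 (setOf_im_le_subset_compl_unboundedComponent S (by simp))

/-- The anchor component is unbounded (it contains the lower half-plane). [folklore] -/
theorem not_isBounded_anchorComponent (S : Set ℂ) : ¬ IsBounded (anchorComponent S) := by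
  intro h
  obtain ⟨C, hC⟩ := (h.subset (setOf_im_le_subset_anchorComponent S)).subset_closedBall 0
  have hmem : (-(((|C| + 1 : ℝ) : ℂ) * I)) ∈ {z : ℂ | z.im ≤ 0} := by
    simp only [mem_setOf_eq, Complex.neg_im, Complex.mul_im, Complex.ofReal_re, Complex.I_im,
      mul_one, Complex.ofReal_im, Complex.I_re, mul_zero, add_zero, neg_nonpos]
    positivity
  have := hC hmem
  rw [mem_closedBall, dist_zero_right, norm_neg, norm_mul, Complex.norm_I, mul_one,
    Complex.norm_real, Real.norm_eq_abs, abs_of_pos (by positivity)] at this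
  linarith [le_abs_self C]

/-- **The complement of the anchor component is open and connected** (`S` closed, bounded):
it is the unbounded component `V` of `ℍ ∖ S` together with the floating components of `ℂ ∖ V`. [folklore] -/
theorem isConnected_compl_anchorComponent (hS : IsClosed S) (hSb : IsBounded S) :
    IsOpen (anchorComponent S)ᶜ ∧ IsConnected (anchorComponent S)ᶜ :=
  ⟨(isClosed_anchorComponent hS hSb).isOpen_compl,
    isConnected_compl_connectedComponentIn (isOpen_unboundedComponent hS hSb)
      (isConnected_unboundedComponent hSb) (-I)⟩

/-- The complement of the anchor component lies in `ℍ`. [folklore] -/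
theorem compl_anchorComponent_subset (S : Set ℂ) : (anchorComponent S)ᶜ ⊆ upperHalfPlaneSet := by
  intro z hz
  by_contra hzH
  exact hz (setOf_im_le_subset_anchorComponent S (show z.im ≤ 0 from not_lt.1 hzH))

/-- **The part of the anchored hull in `ℍ`** is `ℍ ∩ anchorComponent S` (relatively closed). [folklore] -/
theorem anchoredHull_inter (hS : IsClosed S) (hSb : IsBounded S) :
    anchoredHull S ∩ upperHalfPlaneSet = upperHalfPlaneSet ∩ anchorComponent S := by
  refine Subset.antisymm ?_ fun z hz ↦ ⟨subset_closure hz, hz.1⟩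
  rintro z ⟨hzB, hz⟩
  refine ⟨hz, ?_⟩
  have h1 : z ∈ closure (anchorComponent S) := closure_mono inter_subset_right hzB
  rwa [(isClosed_anchorComponent hS hSb).closure_eq] at h1

/-- **`ℍ ∖ anchoredHull S` is the complement of the anchor component.** [folklore] -/
theorem diff_anchoredHull (hS : IsClosed S) (hSb : IsBounded S) :
    upperHalfPlaneSet \ anchoredHull S = (anchorComponent S)ᶜ := by
  ext z
  constructor
  · rintro ⟨hz, hzB⟩ hzC
    exact hzB (subset_closure ⟨hz, hzC⟩)
  · intro hzC
    refine ⟨compl_anchorComponent_subset S hzC, fun hzB ↦ hzC ?_⟩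
    have : z ∈ anchoredHull S ∩ upperHalfPlaneSet := ⟨hzB, compl_anchorComponent_subset S hzC⟩
    rw [anchoredHull_inter hS hSb] at this
    exact this.2

/-- The unbounded component of `ℍ ∖ S` lies in `ℍ ∖ anchoredHull S`. [folklore] -/
theorem unboundedComponent_subset_diff_anchoredHull (hS : IsClosed S) (hSb : IsBounded S) :
    Loewner.unboundedComponent (upperHalfPlaneSet \ S) ⊆ upperHalfPlaneSet \ anchoredHull S := by
  rw [diff_anchoredHull hS hSb]
  exact fun z hzV hzC ↦ anchorComponent_subset_compl S hzC hzV

/-- The anchored hull is contained in the fill. [folklore] -/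
theorem anchoredHull_subset_hpFill (S : Set ℂ) : anchoredHull S ⊆ hpFill S :=
  closure_mono fun _ hz ↦ ⟨hz.1, fun hzV ↦ anchorComponent_subset_compl S hz.2 hzV⟩

/-- The anchored hull is bounded. [folklore] -/
theorem isBounded_anchoredHull (hSb : IsBounded S) : IsBounded (anchoredHull S) :=
  (isBounded_hpFill hSb).subset (anchoredHull_subset_hpFill S)

/-- **The anchored hull of a closed bounded set is a bounded hull** (`∈ 𝒬`), given the
classical criterion `isSimplyConnected_of_isConnected_compl` (hypothesis `hsc`): its complement
in `ℍ` is the open connected complement of the anchor component, whose own complement — the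
anchor component — is connected and unbounded. [folklore] -/
theorem isBoundedHull_anchoredHull (hsc : isSimplyConnected_of_isConnected_compl)
    (hS : IsClosed S) (hSb : IsBounded S) : IsBoundedHull (anchoredHull S) := by
  refine ⟨isBounded_anchoredHull hSb, by rw [anchoredHull_inter hS hSb, anchoredHull], ?_⟩
  rw [diff_anchoredHull hS hSb]
  obtain ⟨hopen, hconn⟩ := isConnected_compl_anchorComponent hS hSb
  refine hsc hopen hconn ?_ ?_
  · rw [compl_compl]; exact isConnected_anchorComponent S
  · rw [compl_compl]; exact not_isBounded_anchorComponent S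

/-- If `0 ∉ hpFill S` then `0 ∉ anchoredHull S`. [folklore] -/
theorem zero_notMem_anchoredHull (h0 : (0 : ℂ) ∉ hpFill S) : (0 : ℂ) ∉ anchoredHull S :=
  fun h ↦ h0 (anchoredHull_subset_hpFill S h)

/-- **The anchored hull is a `*`-hull** as soon as `0 ∉ hpFill S` (`S` closed and bounded). [folklore] -/
theorem isStarHull_anchoredHull (hsc : isSimplyConnected_of_isConnected_compl)
    (hS : IsClosed S) (hSb : IsBounded S) (h0 : (0 : ℂ) ∉ hpFill S) :
    IsStarHull (anchoredHull S) :=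
  ⟨isBoundedHull_anchoredHull hsc hS hSb, zero_notMem_anchoredHull h0⟩

/-- **A transient path from `0` in `ℍ ∪ {0}` avoiding `S` avoids the anchored hull** (`S`
closed, bounded, `0 ∉ S`). [folklore] -/
theorem disjoint_range_anchoredHull (hS : IsClosed S) (hSb : IsBounded S) (h0S : (0 : ℂ) ∉ S)
    {γ : ℝ≥0 → ℂ} (hγc : Continuous γ) (h0 : γ 0 = 0) (hγ : ∀ t, 0 < t → 0 < (γ t).im)
    (htr : Tendsto (fun t ↦ ‖γ t‖) atTop atTop) (hdisj : Disjoint (range γ) S) :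
    Disjoint (range γ) (anchoredHull S) :=
  ((disjoint_range_hpFill_iff hS hSb h0S hγc h0 hγ htr).2 hdisj).mono_right
    (anchoredHull_subset_hpFill S)

/-- **Lower bound, I**: the part in `ℍ` of a closed set `S` attached to the lower half-plane
(`S ∪ {Im ≤ 0}` connected) lies in its anchored hull: `S ∪ {Im ≤ 0}` is a connected subset of
the complement of the unbounded component containing `−i`. [folklore] -/
theorem inter_subset_anchoredHull (hconn : IsConnected (S ∪ {z : ℂ | z.im ≤ 0})) :
    S ∩ upperHalfPlaneSet ⊆ anchoredHull S := by
  have hTV : S ∪ {z : ℂ | z.im ≤ 0} ⊆ (Loewner.unboundedComponent (upperHalfPlaneSet \ S))ᶜ := by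
    rintro z (hzS | hz) hzV
    · exact hzV.1.2 hzS
    · exact absurd (show 0 < z.im from hzV.1.1) (not_lt.2 hz)
  have hsub : S ∪ {z : ℂ | z.im ≤ 0} ⊆ anchorComponent S :=
    hconn.isPreconnected.subset_connectedComponentIn (Or.inr (by simp)) hTV
  exact fun z hz ↦ subset_closure ⟨hz.2, hsub (Or.inl hz.1)⟩

/-- **Lower bound, II: for attached sets the anchored hull IS the fill.** If `S` is closed and
`S ∪ {Im ≤ 0}` is connected, the complement of the unbounded component `V` of `ℍ ∖ S` is
connected (`isConnected_compl_unboundedComponent`), hence equal to the anchor component, and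
`anchoredHull S = hpFill S`. [folklore] -/
theorem anchoredHull_eq_hpFill (hS : IsClosed S) (hconn : IsConnected (S ∪ {z : ℂ | z.im ≤ 0})) :
    anchoredHull S = hpFill S := by
  have hVc := (isConnected_compl_unboundedComponent hS hconn).1
  have heq : anchorComponent S = (Loewner.unboundedComponent (upperHalfPlaneSet \ S))ᶜ :=
    (connectedComponentIn_subset _ _).antisymm
      (hVc.isPreconnected.subset_connectedComponentIn
        (setOf_im_le_subset_compl_unboundedComponent S (by simp)) Subset.rfl)
  rw [anchoredHull, heq, hpFill]
  rfl

/-- **Monotonicity**: `S ⊆ T` implies `anchoredHull S ⊆ anchoredHull T` (`T` closed and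
bounded): the unbounded component shrinks, so the anchor component grows. [folklore] -/
theorem anchoredHull_mono {T : Set ℂ} (hST : S ⊆ T) : anchoredHull S ⊆ anchoredHull T := by
  refine closure_mono (inter_subset_inter_right _ ?_)
  -- `V_T ⊆ V_S`, hence `V_Sᶜ ⊆ V_Tᶜ` and the component of `-I` grows
  have hV : Loewner.unboundedComponent (upperHalfPlaneSet \ T) ⊆
      Loewner.unboundedComponent (upperHalfPlaneSet \ S) := by
    rintro z ⟨hz, hzb⟩
    have hsub : upperHalfPlaneSet \ T ⊆ upperHalfPlaneSet \ S := sdiff_subset_sdiff_right hST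
    exact ⟨hsub hz, fun hb ↦ hzb (hb.subset (connectedComponentIn_mono z hsub))⟩
  exact connectedComponentIn_mono _ (compl_subset_compl.2 hV)

end Hull

end Literature.Probability.RandomPlanarGeometry

end
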